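import Summits.BirchSwinnertonDyer.BirchSwinnertonDyer.Theorems.KatoDescentPotSupersingularKatoFiniteLevelStrictLimit
import Summits.BirchSwinnertonDyer.Rank1Residual.X11b.LevelShiftMaps
import Literature.NumberTheory.EllipticCurves.PointDivisibilityProofs
import HarnessLib

/-!
# Kato's (14.9.3) at finite level, part 4: `Sel_str^{ur}(K, E[p^∞])` IS REACHED from a finite level — every class of
# Kato's strict group of `E[p^∞]` killed by `p^m` is `ι_{m+e}` of a STRICT class of `E[p^{m+e}]`, for `e` bounding the
# local torsion at `P` and the defect-from-divisibility of the inertia invariants off `P`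
# (route `KatoDescentPotSupersingular` / `…Tame…`, crux M = stmt-BirchSwinnertonDyer-19196; route-free helper)

Seat `bsd-potss-rkm` g17 (prover; cell `bsd-potss`), item stmt-BirchSwinnertonDyer-19196 `ReducibleKatoMember`
(`--supports … --as helper`; closes nothing).  HONEST FRAMING: BSD is not proved by any of this; nothing is booked;
theorems only (no definition, no named fact).  Sequel of `…KatoFiniteLevelStrictLimit` (injectivity of `ι_k` on the
strict group, `#H¹_𝓢(K,E[p^k]) ≤ #Sel_str^{ur}(K,E[p^∞])`); this file gives the converse SURJECTIVITY, hence EQUALITY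
of the two orders at every sufficiently high level, and with part 1 the exact asymptotic count
`#H¹(O_K[1/p], E[p^k]) = #Sel_str^{ur}(K, E[p^∞]) · ∏_{v∣p} #𝓚_v` — the discrete half of the construction (E4) of
FINDING-19196-rkm-g17.

## What

`W` elliptic over a number field `K`, `p` an odd prime, `P` a finite set of finite places; `𝓢` Kato's strict structure on
`E[p^{m+e}]` (`0` at `v ∈ P`, UNRAMIFIED at the finite `v ∉ P`), `𝓢∞` the same on `E[p^∞]` (`primaryGaloisModule`).

* **`exists_mem_selmerGroup_strict_map_primaryInclusion_eq`** — for `c ∈ H¹_{𝓢∞}(K, E[p^∞])` with `p^m · c = 0` there is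
  `c' ∈ H¹_𝓢(K, E[p^{m+e}])` with `ι_{m+e} c' = c`, GRANTED the local bounds (theorem-shaped, hypotheses):
  (heP) at `v ∈ P`, `p^e` kills the `Γ_{K_v}`-fixed points of `E[p^∞]` (= `E(K_v)[p^∞]`, finite);
  (hN) at every finite `v ∉ P`, for every `I_v`-fixed `x ∈ E[p^∞]` some `I_v`-fixed `d` has `p^{m+e}·d = p^e·x`
  (`p^e · E[p^∞]^{I_v}` is `p`-divisible: automatic at good `v ∤ p` by the divisibility of `E[p^∞]`, and the tree's
  `…PrimaryDivisibleCore` TOOL at the finitely many bad `v ∉ P`).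
  PROOF (cocycles): `c = ι_m[φ]` (`E(K̄)` divisible, X11b `mem_range_map_primaryInclusion_iff`); push `φ` to level `m+e`
  (`Levels.levelIncl`).  At `v ∈ P`: `loc_v c = 0` gives `ι(φ σ) = σW − W` on `Γ_{K_v}`, so `p^m W ∈ E(K_v)[p^∞]`, `p^{m+e}W = 0`,
  `W ∈ E[p^{m+e}]` and the pushed cocycle is the coboundary of `W`.  At finite `v ∉ P`: `loc_v c` unramified gives
  `ι(φ τ) = τW − W` on `I_v` (X11b `mem_unramifiedSubgroup_one_iff_exists`), `x = p^m W` is `I_v`-fixed; with `d` from (hN),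
  `W − d ∈ E[p^{m+e}]` and `τ(W−d) − (W−d) = ι(φ τ)` on `I_v`, so the pushed cocycle is principal on inertia.  At `∞`:
  `H¹(K_w, E[p^{m+e}]) = 0` (`p` odd).
* **`natCard_selmerGroup_strict_eq`** — `#H¹_𝓢(K,E[p^{m+e}]) = #Sel_str^{ur}(K,E[p^∞])` when `p^m` kills the (finite) latter,
  `p^{m+e}` kills `E(K_{v₀})[p^∞]` for some `v₀ ∈ P` (injectivity, part 3) and (heP), (hN) hold;
* **`natCard_selmerGroup_relaxed_eq_of_primary`** — with part 1: `#H¹_ℛ(K,E[p^{m+e}]) = #Sel_str^{ur}(K,E[p^∞]) · ∏_{v∈P}#𝓚_v`.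

References: K. Kato, Astérisque 295 (2004) §8.2, 14.8, (14.9.3)–(14.9.4), Prop. 14.16 [Kato2004Asterisque]; R. Greenberg,
LNM 1716 (1999) §3 Lemma 3.3, §5 Prop. 5.8 [GreenbergLNM1716]; J. H. Silverman, *AEC* VIII §2 [SilvermanAEC2009].
-/

-- the summit and its single problem are both named `BirchSwinnertonDyer` (registry layout D-0017)
set_option linter.dupNamespace false
set_option autoImplicit false

noncomputable section

open scoped Classical ContRepresentation NumberField
open Function Field NumberField IsDedekindDomain WeierstrassCurve
open Literature.NumberTheory.EllipticCurves Literature.NumberTheory.GaloisRepresentations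
  Literature.NumberTheory.GaloisRepresentations.DiscreteGaloisModule Literature.NumberTheory.GaloisCohomology
open Summit.BirchSwinnertonDyer.Rank1Residual.X11b.Levels Summit.BirchSwinnertonDyer.Rank1Residual.X11b.LocBridge
open Summit.BirchSwinnertonDyer.Rank1Residual.GaloisImage

universe u

namespace Summit.BirchSwinnertonDyer.BirchSwinnertonDyer.Theorems.KatoFiniteLevelCount

section Surj

variable {K : Type u} [Field K] [NumberField K] (W : WeierstrassCurve K) [W.IsElliptic] (p : ℕ) [Fact p.Prime]
  (m e : ℕ) (P : Finset (HeightOneSpectrum (𝓞 K)))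
  (𝓢 : SelmerStructure (W.torsionGaloisModule ((p ^ (m + e) : ℕ) : ℤ)))
  (𝓢inf : SelmerStructure (primaryGaloisModule W p))

/-- **Lifting a strict class of `E[p^∞]` to a strict class of `E[p^{m+e}]`.**  For `c ∈ H¹_{𝓢∞}(K, E[p^∞])` with `p^m · c = 0`
(`𝓢∞` zero at `v ∈ P`, unramified at the finite `v ∉ P`), there is `c' ∈ H¹_𝓢(K, E[p^{m+e}])` (`𝓢` of the same shape) with
`ι_{m+e} c' = c`, granted: (heP) `p^e` kills the `Γ_{K_v}`-fixed points of `E[p^∞]` at every `v ∈ P`; (hN) at every finite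
`v ∉ P`, `p^e · (E[p^∞])^{I_v}` is `p^{m}`-divisible inside `(E[p^∞])^{I_v}` in the form
`∀ x, ∃ d, p^{m+e} d = p^e x`; `p` odd (so `H¹(K_w, ·) = 0` at the infinite places).  See the module docstring for the
cocycle proof. [cite: GreenbergLNM1716, §5 proof of Prop. 5.8 and §3 Lemma 3.3] [cite: Kato2004Asterisque, 14.8 and (14.9.3) (pp. 238–240)] -/
theorem exists_mem_selmerGroup_strict_map_primaryInclusion_eq (hodd : p ≠ 2)
    (h𝓢P : ∀ v ∈ P, 𝓢 (Sum.inr v) = ⊥)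
    (h𝓢ur : ∀ v ∉ P, 𝓢 (Sum.inr v) =
      unramifiedSubgroup (GaloisRep.toLocal v (W.torsionGaloisModule ((p ^ (m + e) : ℕ) : ℤ))) 1)
    (hIP : ∀ v ∈ P, 𝓢inf (Sum.inr v) = ⊥)
    (hIur : ∀ v ∉ P, 𝓢inf (Sum.inr v) = unramifiedSubgroup (GaloisRep.toLocal v (primaryGaloisModule W p)) 1)
    (heP : ∀ v ∈ P, ∀ x : W.geomPrimaryTorsion p,
      (∀ σ : absoluteGaloisGroup (v.adicCompletion K), GaloisRep.toLocal v (primaryGaloisModule W p) σ x = x) →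
        p ^ e • x = 0)
    (hN : ∀ v : HeightOneSpectrum (𝓞 K), v ∉ P → ∀ x : W.geomPrimaryTorsion p,
      (∀ τ ∈ absInertia (v.adicCompletion K), GaloisRep.toLocal v (primaryGaloisModule W p) τ x = x) →
        ∃ d : W.geomPrimaryTorsion p,
          (∀ τ ∈ absInertia (v.adicCompletion K), GaloisRep.toLocal v (primaryGaloisModule W p) τ d = d) ∧
            p ^ (m + e) • d = p ^ e • x)
    {c : galoisCohomology (primaryGaloisModule W p) 1} (hc : c ∈ 𝓢inf.selmerGroup) (hm : p ^ m • c = 0) :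
    ∃ c' ∈ 𝓢.selmerGroup, galoisCohomology.map (primaryInclusion W p (m + e)) 1 c' = c := by
  have hdiv : W.zsmul_geomPoints_surjective := W.zsmul_geomPoints_surjective_holds
  -- `c = ι_m c_m`
  obtain ⟨cm, hcm⟩ := (mem_range_map_primaryInclusion_iff W p m hdiv c).2 hm
  refine ⟨galoisCohomology.map (levelIncl W p m e) 1 cm, ?_, by rw [map_primaryInclusion_map_levelIncl, hcm]⟩
  rw [SelmerStructure.mem_selmerGroup_iff]
  intro v
  rcases v with w | v
  · -- infinite places: `H¹(K_w, E[p^{m+e}]) = 0` for odd `p`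
    have hoddn : Odd (((p ^ (m + e) : ℕ) : ℤ)) := by
      exact_mod_cast ((Fact.out : p.Prime).odd_of_ne_two hodd).pow
    rw [galoisCohomology_one_torsion_eq_zero_infinitePlace_of_odd W w hoddn
      (galoisCohomology.localization _ (Sum.inl w) 1 (galoisCohomology.map (levelIncl W p m e) 1 cm))]
    exact zero_mem _
  · -- finite places: a cocycle `ψ` for `loc_v c_m`; `loc_v` of the pushed class is `[levelIncl ∘ ψ]`
    obtain ⟨ψ, hψ⟩ := oneCocycleClass_surjective _ (galoisCohomology.localization _ (Sum.inr v) 1 cm)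
    set ψ' := contOneCocycles.pullback (ContinuousMonoidHom.id _)
      (X := DiscreteGaloisModule.toTopRep ((W.torsionGaloisModule ((p ^ m : ℕ) : ℤ)).toLocal (Sum.inr v)))
      (Y := DiscreteGaloisModule.toTopRep ((W.torsionGaloisModule ((p ^ (m + e) : ℕ) : ℤ)).toLocal (Sum.inr v)))
      (TopRep.ofHom ⟨((levelIncl W p m e).restrictField (Place.Completion (Sum.inr v : Place K))).toContinuousLinearMap,
        ((levelIncl W p m e).restrictField (Place.Completion (Sum.inr v : Place K))).isIntertwining'⟩) ψ with hψ'
    have hpush : galoisCohomology.localization _ (Sum.inr v) 1 (galoisCohomology.map (levelIncl W p m e) 1 cm) =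
        oneCocycleClass _ ψ' := by
      rw [localization_map_one', ← hψ]
      exact galoisCohomology.map_one_oneCocycleClass _ ψ
    rw [hpush]
    -- `loc_v c = [ι_m ∘ ψ]`
    set ψι := contOneCocycles.pullback (ContinuousMonoidHom.id _)
      (X := DiscreteGaloisModule.toTopRep ((W.torsionGaloisModule ((p ^ m : ℕ) : ℤ)).toLocal (Sum.inr v)))
      (Y := DiscreteGaloisModule.toTopRep ((primaryGaloisModule W p).toLocal (Sum.inr v)))
      (TopRep.ofHom ⟨((primaryInclusion W p m).restrictField (Place.Completion (Sum.inr v : Place K))).toContinuousLinearMap,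
        ((primaryInclusion W p m).restrictField (Place.Completion (Sum.inr v : Place K))).isIntertwining'⟩) ψ with hψι
    have hcv : galoisCohomology.localization _ (Sum.inr v) 1 c = oneCocycleClass _ ψι := by
      rw [← hcm, localization_map_one', ← hψ]
      exact galoisCohomology.map_one_oneCocycleClass _ ψ
    -- values of the two pulled-back cocycles
    have hψ'_apply : ∀ σ, (ψ'.1 σ : W.geomTorsion ((p ^ (m + e) : ℕ) : ℤ)) = levelIncl W p m e (ψ.1 σ) := fun σ => rfl
    have hψι_apply : ∀ σ, (ψι.1 σ : W.geomPrimaryTorsion p) = primaryInclusion W p m (ψ.1 σ) := fun σ => rfl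
    -- the Galois action on `E[p^∞]|_{K_v}` commutes with `ι`
    have hι : ∀ (k : ℕ) (σ : absoluteGaloisGroup (v.adicCompletion K)) (T : W.geomTorsion ((p ^ k : ℕ) : ℤ)),
        primaryInclusion W p k (GaloisRep.toLocal v (W.torsionGaloisModule ((p ^ k : ℕ) : ℤ)) σ T) =
          GaloisRep.toLocal v (primaryGaloisModule W p) σ (primaryInclusion W p k T) := by
      intro k σ T
      have h := ((primaryInclusion W p k).restrictField (v.adicCompletion K)).isIntertwining σ T
      rwa [ContinuousRep.toContRepresentation_apply_apply, ContinuousRep.toContRepresentation_apply_apply,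
        ContIntertwiningMap.restrictField_apply, ContIntertwiningMap.restrictField_apply] at h
    -- `p^m • (σ Wpt − Wpt) = 0` whenever `ι_m (ψ σ) = σ Wpt − Wpt`
    have hfixW : ∀ (σ : absoluteGaloisGroup (v.adicCompletion K)) (Wpt : W.geomPrimaryTorsion p),
        primaryInclusion W p m (ψ.1 σ) = GaloisRep.toLocal v (primaryGaloisModule W p) σ Wpt - Wpt →
          GaloisRep.toLocal v (primaryGaloisModule W p) σ (p ^ m • Wpt) = p ^ m • Wpt := by
      intro σ Wpt h
      have h2 : p ^ m • (GaloisRep.toLocal v (primaryGaloisModule W p) σ Wpt - Wpt) = 0 := by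
        rw [← h, ← map_nsmul, pow_nsmul_geomTorsion_eq_zero, map_zero]
      rw [smul_sub, ← map_nsmul, sub_eq_zero] at h2
      exact h2
    by_cases hv : v ∈ P
    · -- `v ∈ P`: `loc_v c = 0`
      have h0 : galoisCohomology.localization _ (Sum.inr v) 1 c = 0 := by
        have h := (SelmerStructure.mem_selmerGroup_iff _ _).1 hc (Sum.inr v)
        rwa [hIP v hv, AddSubgroup.mem_bot] at h
      rw [hcv] at h0
      obtain ⟨Wpt, hW⟩ := (oneCocycleClass_eq_zero_iff _ ψι).mp h0
      have hW' : ∀ σ : absoluteGaloisGroup (v.adicCompletion K),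
          primaryInclusion W p m (ψ.1 σ) = GaloisRep.toLocal v (primaryGaloisModule W p) σ Wpt - Wpt :=
        fun σ => (hψι_apply σ).symm.trans (hW σ)
      -- `p^m Wpt` is `Γ_{K_v}`-fixed, hence killed by `p^e`
      have hkill : p ^ (m + e) • Wpt = 0 := by
        rw [add_comm, pow_add, mul_smul]
        exact heP v hv _ fun σ => hfixW σ Wpt (hW' σ)
      obtain ⟨w, hw⟩ := exists_primaryInclusion_eq_of_nsmul_eq_zero W p (m + e) Wpt hkill
      rw [h𝓢P v hv, AddSubgroup.mem_bot]
      refine (oneCocycleClass_eq_zero_iff _ ψ').mpr ⟨w, fun σ => primaryInclusion_injective W p (m + e) ?_⟩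
      rw [hψ'_apply, map_sub, primaryInclusion_levelIncl]
      change primaryInclusion W p m (ψ.1 σ) =
        primaryInclusion W p (m + e) (GaloisRep.toLocal v (W.torsionGaloisModule ((p ^ (m + e) : ℕ) : ℤ)) σ w) -
          primaryInclusion W p (m + e) w
      rw [hι, hw]
      exact hW' σ
    · -- finite `v ∉ P`: `loc_v c` unramified
      have hur : galoisCohomology.localization _ (Sum.inr v) 1 c ∈
          unramifiedSubgroup (GaloisRep.toLocal v (primaryGaloisModule W p)) 1 := by
        have h := (SelmerStructure.mem_selmerGroup_iff _ _).1 hc (Sum.inr v)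
        rwa [hIur v hv] at h
      rw [hcv] at hur
      obtain ⟨Wpt, hW⟩ := (Rank1Residual.X11b.LocBridge.mem_unramifiedSubgroup_one_iff_exists
        (GaloisRep.toLocal v (primaryGaloisModule W p)) ψι).mp hur
      have hW' : ∀ τ ∈ absInertia (v.adicCompletion K),
          primaryInclusion W p m (ψ.1 τ) = GaloisRep.toLocal v (primaryGaloisModule W p) τ Wpt - Wpt :=
        fun τ hτ => (hψι_apply τ).symm.trans (hW τ hτ)
      -- `x = p^m Wpt` is `I_v`-fixed; take `d` from (hN)
      obtain ⟨d, hd, hdx⟩ := hN v hv (p ^ m • Wpt) fun τ hτ => hfixW τ Wpt (hW' τ hτ)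
      -- `W' = Wpt - d ∈ E[p^{m+e}]`
      have hkill : p ^ (m + e) • (Wpt - d) = 0 := by
        rw [smul_sub, hdx, add_comm, pow_add, mul_smul, sub_self]
      obtain ⟨w, hw⟩ := exists_primaryInclusion_eq_of_nsmul_eq_zero W p (m + e) (Wpt - d) hkill
      rw [h𝓢ur v hv]
      refine (Rank1Residual.X11b.LocBridge.mem_unramifiedSubgroup_one_iff_exists
        (GaloisRep.toLocal v (W.torsionGaloisModule ((p ^ (m + e) : ℕ) : ℤ))) ψ').mpr
        ⟨w, fun τ hτ => primaryInclusion_injective W p (m + e) ?_⟩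
      change primaryInclusion W p (m + e) (levelIncl W p m e (ψ.1 τ)) =
        primaryInclusion W p (m + e)
          (GaloisRep.toLocal v (W.torsionGaloisModule ((p ^ (m + e) : ℕ) : ℤ)) τ w - w)
      rw [map_sub, primaryInclusion_levelIncl, hι, hw, map_sub, hd τ hτ, hW' τ hτ]
      abel

/-- **`#H¹_𝓢(K, E[p^{m+e}]) = #Sel_str^{ur}(K, E[p^∞])`** for Kato's strict structures, when `Sel_str^{ur}(K,E[p^∞]) =
H¹_{𝓢∞}` is finite and killed by `p^m`, `p^{m+e}` kills `E(K_{v₀})[p^∞]` for some `v₀ ∈ P` (injectivity of `ι_{m+e}`, part 3),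
and the local bounds (heP), (hN) hold (surjectivity): the two groups are in bijection under `ι_{m+e}`.
[cite: Kato2004Asterisque, (14.9.3)–(14.9.4) (p. 240)] [cite: GreenbergLNM1716, §5 proof of Prop. 5.8] -/
theorem natCard_selmerGroup_strict_eq (hodd : p ≠ 2) [Finite 𝓢inf.selmerGroup]
    (h𝓢P : ∀ v ∈ P, 𝓢 (Sum.inr v) = ⊥)
    (h𝓢ur : ∀ v ∉ P, 𝓢 (Sum.inr v) =
      unramifiedSubgroup (GaloisRep.toLocal v (W.torsionGaloisModule ((p ^ (m + e) : ℕ) : ℤ))) 1)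
    (hIP : ∀ v ∈ P, 𝓢inf (Sum.inr v) = ⊥)
    (hIur : ∀ v ∉ P, 𝓢inf (Sum.inr v) = unramifiedSubgroup (GaloisRep.toLocal v (primaryGaloisModule W p)) 1)
    (hIinl : ∀ w : InfinitePlace K, 𝓢inf (Sum.inl w) = ⊤)
    (hm : ∀ c ∈ 𝓢inf.selmerGroup, p ^ m • c = 0)
    (heP : ∀ v ∈ P, ∀ x : W.geomPrimaryTorsion p,
      (∀ σ : absoluteGaloisGroup (v.adicCompletion K), GaloisRep.toLocal v (primaryGaloisModule W p) σ x = x) →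
        p ^ e • x = 0)
    (hN : ∀ v : HeightOneSpectrum (𝓞 K), v ∉ P → ∀ x : W.geomPrimaryTorsion p,
      (∀ τ ∈ absInertia (v.adicCompletion K), GaloisRep.toLocal v (primaryGaloisModule W p) τ x = x) →
        ∃ d : W.geomPrimaryTorsion p,
          (∀ τ ∈ absInertia (v.adicCompletion K), GaloisRep.toLocal v (primaryGaloisModule W p) τ d = d) ∧
            p ^ (m + e) • d = p ^ e • x)
    {v₀ : HeightOneSpectrum (𝓞 K)} (hv₀P : v₀ ∈ P) :
    Nat.card 𝓢.selmerGroup = Nat.card 𝓢inf.selmerGroup := by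
  -- `p^{m+e}` kills `E(K_{v₀})[p^∞]` since `p^e` does
  have hk : ∀ Q : W.geomPrimaryTorsion p,
      (∀ σ : absoluteGaloisGroup (v₀.adicCompletion K),
        GaloisRep.restrictField (v₀.adicCompletion K) (primaryGaloisModule W p) σ Q = Q) → p ^ (m + e) • Q = 0 := by
    intro Q hQ
    rw [pow_add, mul_smul, heP v₀ hv₀P Q hQ, smul_zero]
  refine le_antisymm (natCard_selmerGroup_strict_le W p (m + e) P 𝓢 𝓢inf h𝓢P h𝓢ur hIP hIur hIinl hv₀P hk) ?_
  -- surjectivity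
  let f : 𝓢.selmerGroup → 𝓢inf.selmerGroup := fun c =>
    ⟨galoisCohomology.map (primaryInclusion W p (m + e)) 1 c,
      map_primaryInclusion_mem_selmerGroup_strict W p (m + e) P 𝓢 𝓢inf h𝓢P h𝓢ur hIP hIur hIinl c.2⟩
  have hf : Surjective f := by
    intro c
    obtain ⟨c', hc', hcc'⟩ := exists_mem_selmerGroup_strict_map_primaryInclusion_eq W p m e P 𝓢 𝓢inf hodd h𝓢P h𝓢ur
      hIP hIur heP hN c.2 (hm c c.2)
    exact ⟨⟨c', hc'⟩, Subtype.ext hcc'⟩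
  have hfinj : Injective f := fun x y hxy => by
    apply Subtype.ext
    have h : galoisCohomology.map (primaryInclusion W p (m + e)) 1 (x - y : 𝓢.selmerGroup) = 0 := by
      rw [AddSubgroupClass.coe_sub, map_sub, sub_eq_zero]; exact congrArg Subtype.val hxy
    have h' := map_primaryInclusion_injOn_selmerGroup_strict W p (m + e) 𝓢 (h𝓢P v₀ hv₀P) hk (x - y).2 h
    rwa [AddSubgroupClass.coe_sub, sub_eq_zero] at h'
  haveI : Finite 𝓢.selmerGroup := Finite.of_injective f hfinj
  exact Nat.card_le_card_of_surjective f hf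


/-- **The exact count `#H¹_ℛ(K, E[p^{m+e}]) = #Sel_str^{ur}(K, E[p^∞]) · ∏_{v∈P} #𝓚_v`** (Kato's (14.9.3)/(14.16.2) with the
strict side passed to `E[p^∞]`): part 1's finite-level count (`natCard_selmerGroup_relaxed_eq_of_weilPairing`) combined with
`natCard_selmerGroup_strict_eq`.  Hypotheses: a Poitou–Tate family `inv` at level `p^{m+e}`, `P ⊆ T` with `P ⊇ {v ∣ p}` and `T ⊇`
the ramification of `E[p^{m+e}]`, Kato's structures `𝓢 ≤ ℛ` on `E[p^{m+e}]` and `𝓢∞` on `E[p^∞]`, and the local bounds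
(heP), (hN) with `p^m · Sel_str^{ur} = 0`.  For `K = ℚ`, `P = {p}`: `#H¹(ℤ[1/p], E[p^k]) = #Sel_str^{ur}(ℚ, E[p^∞]) · #E(ℚ_p)[p^k] · p^k`
for all `k ≫ 0` — on Kato's side `#H¹(ℤ[1/p],T)/p^k · #H²(ℤ[1/p],T)[p^k]`-type growth with `rank H¹(ℤ[1/p],T) = 1`.
[cite: Kato2004Asterisque, (14.9.3)–(14.9.4) (p. 240) and Prop. 14.16 (p. 244)] -/
theorem natCard_selmerGroup_relaxed_eq_of_primary (hodd : p ≠ 2) (hme : 1 ≤ m + e) [Finite 𝓢inf.selmerGroup]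
    (inv : LocalInvariants K (p ^ (m + e))) (hperf : inv.IsPerfect) (hsum : inv.SumLocalTermEqZero)
    (hcompl : inv.SelmerComplement)
    (T : Finset (HeightOneSpectrum (𝓞 K))) (hPT : P ⊆ T)
    (hP : ∀ v : HeightOneSpectrum (𝓞 K), ((p ^ (m + e) : ℕ) : 𝓞 K) ∈ v.asIdeal → v ∈ P)
    (hT : ∀ v : HeightOneSpectrum (𝓞 K), v ∉ T →
      GaloisRep.IsUnramifiedAt v (W.torsionGaloisModule ((p ^ (m + e) : ℕ) : ℤ)))
    (ℛ : SelmerStructure (W.torsionGaloisModule ((p ^ (m + e) : ℕ) : ℤ)))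
    (h𝓢P : ∀ v ∈ P, 𝓢 (Sum.inr v) = ⊥) (hℛP : ∀ v ∈ P, ℛ (Sum.inr v) = ⊤)
    (h𝓢ur : ∀ v ∉ P, 𝓢 (Sum.inr v) =
      unramifiedSubgroup (GaloisRep.toLocal v (W.torsionGaloisModule ((p ^ (m + e) : ℕ) : ℤ))) 1)
    (hℛur : ∀ v ∉ P, ℛ (Sum.inr v) =
      unramifiedSubgroup (GaloisRep.toLocal v (W.torsionGaloisModule ((p ^ (m + e) : ℕ) : ℤ))) 1)
    (hIP : ∀ v ∈ P, 𝓢inf (Sum.inr v) = ⊥)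
    (hIur : ∀ v ∉ P, 𝓢inf (Sum.inr v) = unramifiedSubgroup (GaloisRep.toLocal v (primaryGaloisModule W p)) 1)
    (hIinl : ∀ w : InfinitePlace K, 𝓢inf (Sum.inl w) = ⊤)
    (hm : ∀ c ∈ 𝓢inf.selmerGroup, p ^ m • c = 0)
    (heP : ∀ v ∈ P, ∀ x : W.geomPrimaryTorsion p,
      (∀ σ : absoluteGaloisGroup (v.adicCompletion K), GaloisRep.toLocal v (primaryGaloisModule W p) σ x = x) →
        p ^ e • x = 0)
    (hN : ∀ v : HeightOneSpectrum (𝓞 K), v ∉ P → ∀ x : W.geomPrimaryTorsion p,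
      (∀ τ ∈ absInertia (v.adicCompletion K), GaloisRep.toLocal v (primaryGaloisModule W p) τ x = x) →
        ∃ d : W.geomPrimaryTorsion p,
          (∀ τ ∈ absInertia (v.adicCompletion K), GaloisRep.toLocal v (primaryGaloisModule W p) τ d = d) ∧
            p ^ (m + e) • d = p ^ e • x)
    {v₀ : HeightOneSpectrum (𝓞 K)} (hv₀P : v₀ ∈ P) :
    Nat.card ℛ.selmerGroup =
      Nat.card 𝓢inf.selmerGroup * ∏ v ∈ P, Nat.card (W.kummerSelmerStructure ((p ^ (m + e) : ℕ) : ℤ) (Sum.inr v)) := by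
  haveI : NeZero (p ^ (m + e)) := ⟨pow_ne_zero _ (Fact.out : p.Prime).ne_zero⟩
  have hn : IsPrimePow (p ^ (m + e)) := (Fact.out : p.Prime).isPrimePow.pow (by omega)
  have hoddn : Odd (p ^ (m + e)) := ((Fact.out : p.Prime).odd_of_ne_two hodd).pow
  rw [natCard_selmerGroup_relaxed_eq_of_weilPairing W (p ^ (m + e)) hn hoddn inv hperf hsum hcompl P T hPT hP hT 𝓢 ℛ
      h𝓢P hℛP h𝓢ur hℛur,
    natCard_selmerGroup_strict_eq W p m e P 𝓢 𝓢inf hodd h𝓢P h𝓢ur hIP hIur hIinl hm heP hN hv₀P]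

end Surj

end Summit.BirchSwinnertonDyer.BirchSwinnertonDyer.Theorems.KatoFiniteLevelCount

end
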